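/-
Copyright (c) 2026 the pub-hodgecm-mathlib formalisation cell (harness21).  Prover seat hodgecm-mathlib-LH5-p02 (g11): E1 row 47a′ «SNAKE EULER CHARACTERISTIC»
(E1 keeper ∕ dealer F0P3a-p03 (g29); census row 47 «NON-ELLIPTIC VANISHING OF `f_EP^{V,e}`» F0P3-p02 (g26), §2 (A3) ∕ §5 R47-a as reshaped 2026-09-03T02:22Z), 2026-09-03.
-/
import Mathlib.Algebra.Module.SnakeLemma
import Mathlib.LinearAlgebra.FiniteDimensional.Lemmas
import Mathlib.LinearAlgebra.Dimension.RankNullity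
import Mathlib.RingTheory.Finiteness.Finsupp
import HarnessLib

/-!
# The snake Euler characteristic: an injective endomorphism of a short exact sequence with finite-dimensional right end has cokernels of equal dimension at the other two

Topic `LinearAlgebra`; namespace `LinearMap` (deliberate dot-notation extension); THEOREMS ONLY (no definition, instance, notation or named fact); Mathlib-footed.  Cell
`pub/hodgecm-mathlib` (D-0151), crux H413 = `stmt-HodgeConjecture-24833`, lane `--supports`; E1 census row 47 (F0P3-p02 (g26)) §2 (A3) «`d(x₀) + d(x₁) = d(e₀) + d(e₁)`:
the Jacquet module `V_N` of the Schneider–Stuhler resolution is torsion over `ℂ[τ^±]`, the chain modules are free», row R47-a′ as the keeper reshaped it («SNAKE form», consumed by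
47c FILE 3).  Count-neutral generic base layer; HC_CM is proved only modulo the 7 printed citations (2 remaining named inputs: hLiu418 = `stmt-HodgeConjecture-24832`, h413 =
`stmt-HodgeConjecture-24833`) until rung 0 closes.

THE STATEMENT.  `0 → A →f B →g C → 0` an exact sequence of `k`-vector spaces (any dimension) with commuting endomorphisms `a, b, c` (`f ∘ a = b ∘ f`, `g ∘ b = c ∘ g`), `b` INJECTIVE
and `C` FINITE-DIMENSIONAL.  Then **`finrank (A ⧸ range a) = finrank (B ⧸ range b)`** (`finrank_quotient_range_eq_of_exact`) — with Mathlib's convention `finrank = 0` on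
infinite-dimensional spaces, so NO finiteness of `A`, `B` or the cokernels is assumed (in the application `A = ℂ[τ^±] ⊗ W₁`, `B = ℂ[τ^±] ⊗ W₀`, `a, b = r(τ) − 1`, `C = V_N`).
PROOF.  `a` is injective too; Mathlib's module snake lemma (`SnakeLemma.δ'`, `exact_δ'_right`, `exact_δ'_left`) gives `0 → ker c →δ coker a →G coker b`, and by hand `coker a →G coker b
→H coker c → 0` (`exact_mapQ_mapQ_of_exact`, `mapQ_surjective_of_surjective`); rank–nullity on `C` gives `finrank (ker c) = finrank (coker c)`; a four-term exact sequence
`0 → K → X → Y → Z → 0` with `finrank K = finrank Z` (both finite-dimensional) has `finrank X = finrank Y`, the infinite-dimensional case included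
(`finrank_eq_of_exact_of_injective_of_surjective`).

## References
* [Brown1982] K. S. Brown, *Cohomology of Groups*, GTM 87 (1982), III §5–§6 (`H₀`, `H₁` of `ℤ` with coefficients in an induced module; the shift minus identity).
* [BernsteinZelevinsky1976] I. N. Bernstein, A. V. Zelevinsky, *Representations of the group `GL(n,F)`*, Russian Math. Surveys 31 (1976), §2.3 (Jacquet modules, exactness).
* [Casselman1995] W. Casselman, *Introduction to the theory of admissible representations of `p`-adic reductive groups* (1995 notes), §6.3 (Jacquet modules of induced
  representations: the `ℤ`-filtration by Bruhat cells).
-/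

set_option autoImplicit false

namespace LinearMap

open Function Module

section Cokernels

variable {k : Type*} [Field k] {A B C : Type*} [AddCommGroup A] [Module k A] [AddCommGroup B] [Module k B] [AddCommGroup C] [Module k C]

/-- If `f` is injective and `f ∘ a = b ∘ f` with `b` injective then `a` is injective. [cite: Brown1982, III §5] -/
theorem injective_of_comp_eq_comp_of_injective (f : A →ₗ[k] B) (hf : Injective f) (a : A →ₗ[k] A) (b : B →ₗ[k] B) (hab : f ∘ₗ a = b ∘ₗ f)
    (hb : Injective b) : Injective a := by
  intro x y hxy
  apply hf
  apply hb
  have h1 := LinearMap.congr_fun hab x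
  have h2 := LinearMap.congr_fun hab y
  simp only [LinearMap.comp_apply] at h1 h2
  rw [← h1, ← h2, hxy]

/-- `f (range a) ≤ range b` when `f ∘ a = b ∘ f`: the map `f` descends to the cokernels `A ⧸ range a → B ⧸ range b` (Mathlib `Submodule.mapQ`). [cite: Brown1982, III §5] -/
theorem range_le_comap_range_of_comp_eq_comp (f : A →ₗ[k] B) (a : A →ₗ[k] A) (b : B →ₗ[k] B) (hab : f ∘ₗ a = b ∘ₗ f) :
    LinearMap.range a ≤ (LinearMap.range b).comap f := by
  rintro _ ⟨x, rfl⟩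
  rw [Submodule.mem_comap, ← LinearMap.comp_apply, hab, LinearMap.comp_apply]
  exact LinearMap.mem_range_self b (f x)

/-- **EXACTNESS OF THE COKERNEL ROW AT THE MIDDLE**: for `A →f B →g C` exact with `g` surjective and commuting endomorphisms `a, b, c`, the induced maps of cokernels
`A ⧸ range a →G B ⧸ range b →H C ⧸ range c` are exact at `B ⧸ range b`. [cite: Brown1982, III §5] -/
theorem exact_mapQ_mapQ_of_exact (f : A →ₗ[k] B) (g : B →ₗ[k] C) (hfg : Exact f g) (hg : Surjective g)
    (a : A →ₗ[k] A) (b : B →ₗ[k] B) (c : C →ₗ[k] C) (hab : f ∘ₗ a = b ∘ₗ f) (hbc : g ∘ₗ b = c ∘ₗ g) :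
    Exact (Submodule.mapQ (LinearMap.range a) (LinearMap.range b) f (range_le_comap_range_of_comp_eq_comp f a b hab))
      (Submodule.mapQ (LinearMap.range b) (LinearMap.range c) g (range_le_comap_range_of_comp_eq_comp g b c hbc)) := by
  intro y
  constructor
  · intro hy
    obtain ⟨y, rfl⟩ := Submodule.mkQ_surjective (LinearMap.range b) y
    rw [Submodule.mkQ_apply, Submodule.mapQ_apply, Submodule.Quotient.mk_eq_zero, LinearMap.mem_range] at hy
    obtain ⟨z, hz⟩ := hy
    obtain ⟨y', rfl⟩ := hg z
    -- `g (y - b y') = 0`, so `y - b y' = f x`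
    have hgb : g (b y') = c (g y') := by rw [← LinearMap.comp_apply, hbc, LinearMap.comp_apply]
    have hker : g (y - b y') = 0 := by
      rw [map_sub, hgb, hz, sub_self]
    obtain ⟨x, hx⟩ := (hfg (y - b y')).1 hker
    refine ⟨Submodule.Quotient.mk x, ?_⟩
    rw [Submodule.mapQ_apply, Submodule.mkQ_apply, hx, Submodule.Quotient.eq, sub_sub_cancel_left, Submodule.neg_mem_iff]
    exact LinearMap.mem_range_self b y'
  · rintro ⟨x, rfl⟩
    obtain ⟨x, rfl⟩ := Submodule.mkQ_surjective (LinearMap.range a) x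
    rw [Submodule.mkQ_apply, Submodule.mapQ_apply, Submodule.mapQ_apply, hfg.apply_apply_eq_zero, Submodule.Quotient.mk_zero]

/-- The last cokernel map `B ⧸ range b → C ⧸ range c` is surjective when `g` is (the ranges instance of ★ `Literature.Algebra.Module.Extensions.mapQ_surjective_of_surjective`,
kept here Mathlib-only to avoid that file's imports). [cite: Brown1982, III §5] -/
theorem mapQ_surjective_of_surjective (g : B →ₗ[k] C) (hg : Surjective g) (b : B →ₗ[k] B) (c : C →ₗ[k] C) (hbc : g ∘ₗ b = c ∘ₗ g) :
    Surjective (Submodule.mapQ (LinearMap.range b) (LinearMap.range c) g (range_le_comap_range_of_comp_eq_comp g b c hbc)) := by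
  intro z
  obtain ⟨z, rfl⟩ := Submodule.mkQ_surjective (LinearMap.range c) z
  obtain ⟨y, rfl⟩ := hg z
  exact ⟨Submodule.Quotient.mk y, by rw [Submodule.mapQ_apply, Submodule.mkQ_apply]⟩

end Cokernels

section Euler

variable {k : Type*} [Field k] {K X Y Z : Type*} [AddCommGroup K] [Module k K] [AddCommGroup X] [Module k X] [AddCommGroup Y] [Module k Y] [AddCommGroup Z] [Module k Z]

/-- **EULER CHARACTERISTIC OF A FOUR-TERM EXACT SEQUENCE**: `0 → K →δ X →G Y →H Z → 0` exact (`δ` injective, `H` surjective) with `K`, `Z` finite-dimensional of the SAME dimension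
forces `finrank X = finrank Y` — including the case where `X`, `Y` are infinite-dimensional (then both `finrank`s are `0`: `X` is finite-dimensional iff `Y` is).
[cite: Brown1982, III §6] -/
theorem finrank_eq_of_exact_of_injective_of_surjective (δ : K →ₗ[k] X) (G : X →ₗ[k] Y) (H : Y →ₗ[k] Z) (hδ : Injective δ) (hδG : Exact δ G) (hGH : Exact G H)
    (hH : Surjective H) [FiniteDimensional k K] [FiniteDimensional k Z] (hKZ : finrank k K = finrank k Z) : finrank k X = finrank k Y := by
  -- `ker G ≃ K`, `Y ⧸ ker H ≃ Z`, `X ⧸ ker G ≃ range G = ker H`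
  have hkerG : LinearMap.ker G = LinearMap.range δ := (LinearMap.exact_iff.1 hδG)
  have hkerH : LinearMap.ker H = LinearMap.range G := (LinearMap.exact_iff.1 hGH)
  have eK : K ≃ₗ[k] LinearMap.ker G := (LinearEquiv.ofInjective δ hδ).trans (LinearEquiv.ofEq _ _ hkerG.symm)
  have eZ : (Y ⧸ LinearMap.ker H) ≃ₗ[k] Z := LinearMap.quotKerEquivOfSurjective H hH
  have eG : (X ⧸ LinearMap.ker G) ≃ₗ[k] LinearMap.ker H := (LinearMap.quotKerEquivRange G).trans (LinearEquiv.ofEq _ _ hkerH.symm)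
  haveI : FiniteDimensional k (LinearMap.ker G) := LinearEquiv.finiteDimensional eK
  haveI : FiniteDimensional k (Y ⧸ LinearMap.ker H) := LinearEquiv.finiteDimensional eZ.symm
  by_cases hY : FiniteDimensional k Y
  · -- then `ker H`, hence `X ⧸ ker G`, hence `X` are finite-dimensional
    haveI : FiniteDimensional k (X ⧸ LinearMap.ker G) := LinearEquiv.finiteDimensional eG.symm
    haveI : FiniteDimensional k X := Module.Finite.of_submodule_quotient (LinearMap.ker G)
    have hX := (LinearMap.ker G).finrank_quotient_add_finrank
    have hY' := (LinearMap.ker H).finrank_quotient_add_finrank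
    rw [← hX, ← hY', eG.finrank_eq, ← eK.finrank_eq, eZ.finrank_eq, hKZ, add_comm]
  · -- then `X` is infinite-dimensional as well
    have hX : ¬ FiniteDimensional k X := by
      intro hXf
      apply hY
      haveI : FiniteDimensional k (LinearMap.ker H) := LinearEquiv.finiteDimensional eG
      exact Module.Finite.of_submodule_quotient (LinearMap.ker H)
    rw [finrank_of_not_finite hX, finrank_of_not_finite hY]

end Euler

section Snake

variable {k : Type*} [Field k] {A B C : Type*} [AddCommGroup A] [Module k A] [AddCommGroup B] [Module k B] [AddCommGroup C] [Module k C]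

/-- Rank–nullity for an endomorphism of a finite-dimensional space: `finrank (ker c) = finrank (C ⧸ range c)`. [cite: Brown1982, III §6] -/
theorem finrank_ker_eq_finrank_quotient_range [FiniteDimensional k C] (c : C →ₗ[k] C) :
    finrank k (LinearMap.ker c) = finrank k (C ⧸ LinearMap.range c) := by
  have h1 := c.finrank_range_add_finrank_ker
  have h2 := (LinearMap.range c).finrank_quotient_add_finrank
  omega

/-- **THE SNAKE EULER CHARACTERISTIC.**  `0 → A →f B →g C → 0` exact (`f` injective, `g` surjective, `Exact f g`) with commuting endomorphisms `a, b, c` (`f ∘ a = b ∘ f`,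
`g ∘ b = c ∘ g`), `b` INJECTIVE, `C` FINITE-DIMENSIONAL ⇒ **`finrank (A ⧸ range a) = finrank (B ⧸ range b)`** (Mathlib's `finrank = 0` on infinite-dimensional spaces makes this
true with no finiteness assumed on `A`, `B`).  Snake: `0 → ker c → coker a → coker b → coker c → 0` (`ker a = ker b = 0`), and `finrank (ker c) = finrank (coker c)`.
[cite: Brown1982, III §5–§6] [cite: BernsteinZelevinsky1976, §2.3] [cite: Casselman1995, §6.3] -/
theorem finrank_quotient_range_eq_of_exact (f : A →ₗ[k] B) (g : B →ₗ[k] C) (hf : Injective f) (hfg : Exact f g) (hg : Surjective g)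
    (a : A →ₗ[k] A) (b : B →ₗ[k] B) (c : C →ₗ[k] C) (hab : f ∘ₗ a = b ∘ₗ f) (hbc : g ∘ₗ b = c ∘ₗ g) (hb : Injective b) [FiniteDimensional k C] :
    finrank k (A ⧸ LinearMap.range a) = finrank k (B ⧸ LinearMap.range b) := by
  -- the cokernel maps
  set G := Submodule.mapQ (LinearMap.range a) (LinearMap.range b) f (range_le_comap_range_of_comp_eq_comp f a b hab) with hG
  set H := Submodule.mapQ (LinearMap.range b) (LinearMap.range c) g (range_le_comap_range_of_comp_eq_comp g b c hbc) with hH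
  have hGH : Exact G H := exact_mapQ_mapQ_of_exact f g hfg hg a b c hab hbc
  have hHs : Surjective H := mapQ_surjective_of_surjective g hg b c hbc
  -- the snake: `δ : ker c → A ⧸ range a`
  have hι₂ : Exact (LinearMap.ker b).subtype b := LinearMap.exact_subtype_ker_map b
  have hι₃ : Exact (LinearMap.ker c).subtype c := LinearMap.exact_subtype_ker_map c
  have hπ₁ : Exact a (LinearMap.range a).mkQ := LinearMap.exact_map_mkQ_range a
  have hπ₂ : Exact b (LinearMap.range b).mkQ := LinearMap.exact_map_mkQ_range b
  -- the restriction `ker b → ker c` of `g`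
  have hF' : ∀ x : LinearMap.ker b, g ((LinearMap.ker b).subtype x) ∈ LinearMap.ker c := by
    intro x
    rw [LinearMap.mem_ker, ← LinearMap.comp_apply, ← hbc, LinearMap.comp_apply, Submodule.coe_subtype, LinearMap.map_coe_ker, map_zero]
  set F : LinearMap.ker b →ₗ[k] LinearMap.ker c := LinearMap.codRestrict _ (g ∘ₗ (LinearMap.ker b).subtype) hF' with hFdef
  have hF : g.comp (LinearMap.ker b).subtype = (LinearMap.ker c).subtype.comp F := by
    ext x; rfl
  have hGπ : G.comp (LinearMap.range a).mkQ = (LinearMap.range b).mkQ.comp f := by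
    rw [hG, Submodule.mapQ_mkQ]
  set δ := SnakeLemma.δ' a b c f g hfg f g hfg hab hbc (LinearMap.ker c).subtype hι₃ (LinearMap.range a).mkQ hπ₁ hg hf with hδdef
  have hFδ : Exact F δ := SnakeLemma.exact_δ'_right a b c f g hfg f g hfg hab hbc (LinearMap.ker b).subtype hι₂ (LinearMap.ker c).subtype hι₃
    (LinearMap.range a).mkQ hπ₁ hg hf F hF Subtype.val_injective
  have hδG : Exact δ G := SnakeLemma.exact_δ'_left a b c f g hfg f g hfg hab hbc (LinearMap.ker c).subtype hι₃
    (LinearMap.range a).mkQ hπ₁ (LinearMap.range b).mkQ hπ₂ hg hf G hGπ (Submodule.mkQ_surjective _)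
  -- `ker b = 0`, so `δ` is injective
  have hδ : Injective δ := by
    rw [← LinearMap.ker_eq_bot, LinearMap.exact_iff.1 hFδ, LinearMap.range_eq_bot]
    ext x
    have hx0 : x = 0 := by
      apply Subtype.ext
      have hx := x.2
      rw [LinearMap.mem_ker] at hx
      exact hb (by rw [hx, Submodule.coe_zero, map_zero])
    rw [hx0, map_zero, LinearMap.zero_apply]
  exact finrank_eq_of_exact_of_injective_of_surjective δ G H hδ hδG hGH hHs (finrank_ker_eq_finrank_quotient_range c)

end Snake

end LinearMap
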